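import Literature.Barriers.NavierStokesRegularity.NavierStokesInequalityCantorProfilesQ
import Literature.Barriers.NavierStokesRegularity.NavierStokesInequalityProfileBlock
import Literature.Analysis.FluidPDE.NormalisedPressureDisjointSum
import HarnessLib

/-!
# The composite field of Proposition 16 (Ożański 2017, §6.3 Step 3; Scheffer 1987, Lemma 3.2)

Barrier catalogue support file for `NavierStokesRegularity` (D-0021), on the discharge path of
fact D′ `Literature.Barriers.NavierStokesRegularity.NSICantorBlock_of_arrangement`
(`NavierStokesInequalityCantorArrangement`). It is the `𝔐`-pair version of the tree's
`NavierStokesInequalityProfileKinematics` / `…ProfileSlices` / `…ProfileBlock` (the one-point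
Prop. 4.2 / Scheffer 1985, Lemma 2.1): given finitely many structures `(V_i^m, f_i^m, φ_i^m)` on
`U_i^m` with PAIRWISE DISJOINT closures (`IsNSIStructureFamily`; Ożański §6.3 Step 1: "the sets
`K^𝔪` are pairwise disjoint translates of `Ū₁ ∪ Ū₂`") and profile data for them
(`IsNSICantorProfileData` of `NavierStokesInequalityCantorProfilesQ`: Scheffer 1987, (3.14)–(3.24)),
the composite field (Ożański (6.23); Scheffer 1987, (3.25)–(3.26))

  `v(x,t) = Σ_𝔪 (u[a_1^{𝔪,k}(t) v_1^𝔪, q_{1,t}^{𝔪,k}](x) + u[a_2^{𝔪,k}(t) v_2^𝔪, q_{2,t}^{𝔪,k}](x))`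

(`cprofileField V B Q t x = Σ_{(i,m)} u[B_i^m(t)V_i^m, Q_i^m(t)](x)`) satisfies the claims of
Proposition 16 (i)–(iii) in the following PROVED form:

* kinematics: `v ∈ C^∞` on the slab, `div v(t) = 0`, `supp v(t) ⊆ ⋃ R(Ū_i^m)`,
  `|v(x,t)| = Σ_{(i,m)} Q_i^m(t)(R⁻¹x)`, `|v|² = Σ (Q_i^m)²∘R⁻¹`, `∂ₜ|v|² = Σ ∂ₜ(Q_i^m)²∘R⁻¹`
  (at every point at most one summand is nonzero);
* the PRESSURE (6.24): `p̄(t) = Σ p*[B_i^mV_i^m, Q_i^m]` (the tree's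
  `normalisedPressure_sum_of_pairwise_disjoint_of_contDiff` = Ożański's Lemma 3.2 (iii) iterated),
  smooth and axisymmetric, with planar trace `Σ p[B V, Q]` and, near a point of `U_i^m`,
  `|v|² + 2p̄ = (Q_i^m)² + 2Σ_{l,n} p[B_l^nV_l^n, Q_l^n] = cprofilePotential` on the meridian plane;
* the TRANSPORT TERM over `U_i^m`: `v·∇(|v|² + 2p̄) = B_i^m v_i^m·∇(cprofilePotential)` (Case 2),
  and `= 0` off `⋃ R(C_i^m)` (Case 1, (3.30));
* the VISCOUS TERM: `v·Δv ≥ 0` off `⋃ R(C_i^m)` (Case 1 with (3.24): cross terms vanish by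
  disjointness of supports and locality of `Δ`);
* the Navier–Stokes inequality `∂ₜ|v|² ≤ -v·∇(|v|² + 2p̄) + 2ν v·Δv` on `[0,T] × ℝ³` for all
  `ν ∈ [0, δ/(2M_L + 1)]`, GIVEN a lower bound `v·Δv ≥ -M_L` (`nsi_cprofileField`; the bound is
  supplied `j`-uniformly downstream, in place of the one-point compactness constant);
* energy and dissipation of a slice against pointwise bounds
  (`lintegral_enorm_sq_cprofileField_le`, `lintegral_frobenius_cprofileField_le`): Prop. 16 (iv)
  in the form `≤ (bound) · Σ_{(i,m)} |R(Ū_i^m)|`.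

Indices `(i, m) ∈ Fin 2 × A`, `A` a finite type of pair indices (`A = {1,…,𝔐}` in print).

## References

* W. S. Ożański, *On weak solutions to the Navier–Stokes inequality with internal
  singularities*, arXiv:1709.00602v4, §6.3 (Step 1, Step 3: (6.23)–(6.26), Cases 1–2), Lemma 3.2
  (iii), §3.4 (3.24)–(3.31). [`Ozanski2017NSISingular`]
* V. Scheffer, *Nearly one dimensional singularities of solutions to the Navier–Stokes
  inequality*, Comm. Math. Phys. 110 (1987), Lemma 3.2 ((3.14)–(3.41)). [`Scheffer1987`]
* V. Scheffer, Comm. Math. Phys. 101 (1985), Lemma 2.1 ((2.10)–(2.27)). [`Scheffer1985`]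
-/

noncomputable section

open MeasureTheory Set Function Filter Topology TopologicalSpace WithLp Metric
open scoped ENNReal InnerProductSpace RealInnerProductSpace ContDiff Laplacian

namespace Literature.Barriers.NavierStokesRegularity

open Literature.Analysis.FluidPDE

variable {A : Type*} [Fintype A]

/-! ### The composite field and the family of structures -/

/-- **The composite field of Proposition 16**, `v(x,t) = Σ_{(i,m)} u[B_i^m(t) V_i^m, Q_i^m(t)](x)`
(Ożański (6.23): `v = Σ_𝔪 (u[a_1^{𝔪,k}v_1^𝔪, q_1^{𝔪,k}] + u[a_2^{𝔪,k}v_2^𝔪, q_2^{𝔪,k}])`; Scheffer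
1987, (3.25)–(3.26)), time first, summed over the product index `(i, m) : Fin 2 × A`.
[cite: Ozanski2017NSISingular, §6.3 (6.23)] [cite: Scheffer1987, Lemma 3.2 (3.25)–(3.26)] -/
def cprofileField (V : Fin 2 → A → ℝ × ℝ → ℝ × ℝ) (B : Fin 2 → A → ℝ → ℝ)
    (Q : Fin 2 → A → ℝ → ℝ × ℝ → ℝ) (t : ℝ) (x : EuclideanSpace ℝ (Fin 3)) :
    EuclideanSpace ℝ (Fin 3) :=
  ∑ p : Fin 2 × A, swirlField (B p.1 p.2 t • V p.1 p.2) (Q p.1 p.2 t) x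

omit [Fintype A] in
/-- Unfolding `cprofileField`. [folklore] -/
theorem cprofileField_apply [Fintype A] (V : Fin 2 → A → ℝ × ℝ → ℝ × ℝ) (B : Fin 2 → A → ℝ → ℝ)
    (Q : Fin 2 → A → ℝ → ℝ × ℝ → ℝ) (t : ℝ) (x : EuclideanSpace ℝ (Fin 3)) :
    cprofileField V B Q t x = ∑ p : Fin 2 × A, swirlField (B p.1 p.2 t • V p.1 p.2) (Q p.1 p.2 t) x :=
  rfl

/-- **A finite family of structures with pairwise disjoint closures** (Ożański §6.3 Step 1: the
`𝔐` pairs of structures `(v_i^𝔪, f_i^𝔪, φ_i^𝔪)` on `U_i^𝔪`, the sets `K^𝔪 = Ū_1^𝔪 ∪ Ū_2^𝔪` pairwise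
disjoint and `Ū_1^𝔪 ∩ Ū_2^𝔪 = ∅`; Scheffer 1987, (3.15): "the sets `C_i^m` are disjoint").
[cite: Ozanski2017NSISingular, §6.3 Step 1] [cite: Scheffer1987, Lemma 3.2 (3.15)] -/
structure IsNSIStructureFamily (U : Fin 2 → A → Set (ℝ × ℝ)) (V : Fin 2 → A → ℝ × ℝ → ℝ × ℝ)
    (f φ : Fin 2 → A → ℝ × ℝ → ℝ) : Prop where
  /-- Each `(V_i^m, f_i^m, φ_i^m)` is a structure on `U_i^m`. -/
  isNSIStructure : ∀ i m, IsNSIStructure (U i m) (V i m) (f i m) (φ i m)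
  /-- The closures are pairwise disjoint. -/
  disjoint : ∀ p p' : Fin 2 × A, p ≠ p' → Disjoint (closure (U p.1 p.2)) (closure (U p'.1 p'.2))

namespace IsNSIStructureFamily

variable {U : Fin 2 → A → Set (ℝ × ℝ)} {V : Fin 2 → A → ℝ × ℝ → ℝ × ℝ} {f φ : Fin 2 → A → ℝ × ℝ → ℝ}

omit [Fintype A] in
/-- A point of `Ū_i^m` is in no other closure. [folklore] -/
theorem notMem_closure_of_mem [Fintype A] (hF : IsNSIStructureFamily U V f φ) {p p' : Fin 2 × A}
    (hne : p' ≠ p) {q : ℝ × ℝ} (hq : q ∈ closure (U p.1 p.2)) : q ∉ closure (U p'.1 p'.2) :=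
  fun h => Set.disjoint_left.1 (hF.disjoint p' p hne) h hq

/-- The union of the solids of revolution of the closures is compact. [folklore] -/
theorem isCompact_iUnion_revolve (hF : IsNSIStructureFamily U V f φ) :
    IsCompact (⋃ p : Fin 2 × A, revolve (closure (U p.1 p.2))) :=
  _root_.isCompact_iUnion fun p => isCompact_revolve (hF.isNSIStructure p.1 p.2).isCompact_closure

omit [Fintype A] in
/-- The solids of revolution of the closures are measurable. [folklore] -/
theorem measurableSet_revolve (U : Fin 2 → A → Set (ℝ × ℝ)) (p : Fin 2 × A) :
    MeasurableSet (revolve (closure (U p.1 p.2))) :=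
  (isClosed_closure.preimage continuous_meridian).measurableSet

/-- The union of the solids of revolution of the closures is closed. [folklore] -/
theorem isClosed_iUnion_revolve (U : Fin 2 → A → Set (ℝ × ℝ)) :
    IsClosed (⋃ p : Fin 2 × A, revolve (closure (U p.1 p.2))) :=
  isClosed_iUnion_of_finite fun _ => isClosed_closure.preimage continuous_meridian

end IsNSIStructureFamily

namespace IsNSICantorProfileData

variable {U : Fin 2 → A → Set (ℝ × ℝ)} {V : Fin 2 → A → ℝ × ℝ → ℝ × ℝ} {f φ : Fin 2 → A → ℝ × ℝ → ℝ}
  {H : Fin 2 → A → ℝ → ℝ × ℝ → ℝ} {T η δ ε : ℝ} {C : Fin 2 → A → Set (ℝ × ℝ)}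
  {B : Fin 2 → A → ℝ → ℝ} {Q : Fin 2 → A → ℝ → ℝ × ℝ → ℝ}

/-! ### Slices -/

/-- `[0,T] ⊆ J`. [folklore] -/
theorem Icc_subset (h : IsNSICantorProfileData U V f φ H T η δ ε C B Q) :
    Icc (0 : ℝ) T ⊆ Ioo (-η) (T + η) := fun _ ht =>
  ⟨by linarith [h.η_pos, ht.1], by linarith [h.η_pos, ht.2]⟩

/-- **Each summand `(B_i^m(t)V_i^m, Q_i^m(t))`, `t ∈ J`, is slice data on `U_i^m`.**
[cite: Scheffer1987, Lemma 3.2 (3.16)–(3.19), (3.23)] [cite: Ozanski2017NSISingular, §6.3 Step 2] -/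
theorem slice (hF : IsNSIStructureFamily U V f φ) (h : IsNSICantorProfileData U V f φ H T η δ ε C B Q)
    (i : Fin 2) (m : A) {t : ℝ} (ht : t ∈ Ioo (-η) (T + η)) :
    IsNSISlice (U i m) (B i m t • V i m) (Q i m t) where
  isCompact_closure := (hF.isNSIStructure i m).isCompact_closure
  closure_subset := (hF.isNSIStructure i m).closure_subset
  w_smooth := ((hF.isNSIStructure i m).smul (h.abs_B_le i m t)).v_smooth
  g_smooth := IsSmoothSpaceTimeOn.contDiff_slice (h.Q_smooth i m) ht
  g_nonneg := h.Q_nonneg i m t ht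
  tsupport_w := ((tsupport_smul_subset_right (fun _ : ℝ × ℝ => B i m t) (V i m)).trans
    (h.tsupport_V i m)).trans (h.subset i m)
  g_eq_zero := h.Q_eq_zero i m t ht
  sq_lt q hq := (IsNSIProfileData.sq_smul_le (h.abs_B_le i m t) (V i m) q).trans_lt
    (h.sq_lt i m t ht q hq)
  div_eq_zero := ((hF.isNSIStructure i m).smul (h.abs_B_le i m t)).div_eq_zero

/-- Off `R(Ū_i^m)` the `(i,m)` summand vanishes. [cite: Scheffer1987, Lemma 3.2 (3.26)] -/
theorem swirlField_eq_zero (hF : IsNSIStructureFamily U V f φ)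
    (h : IsNSICantorProfileData U V f φ H T η δ ε C B Q) {t : ℝ} (ht : t ∈ Ioo (-η) (T + η))
    (p : Fin 2 × A) {y : EuclideanSpace ℝ (Fin 3)} (hy : meridian y ∉ closure (U p.1 p.2)) :
    swirlField (B p.1 p.2 t • V p.1 p.2) (Q p.1 p.2 t) y = 0 :=
  (h.slice hF p.1 p.2 ht).swirlField_eq_zero hy

/-- **The summands have pairwise disjoint supports**: at every point, of any two summands one
vanishes. [cite: Scheffer1987, Lemma 3.2 (3.15), (3.26)] -/
theorem swirlField_eq_zero_or (hF : IsNSIStructureFamily U V f φ)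
    (h : IsNSICantorProfileData U V f φ H T η δ ε C B Q) {t : ℝ} (ht : t ∈ Ioo (-η) (T + η)) :
    Pairwise fun p p' : Fin 2 × A => ∀ y : EuclideanSpace ℝ (Fin 3),
      swirlField (B p.1 p.2 t • V p.1 p.2) (Q p.1 p.2 t) y = 0 ∨
        swirlField (B p'.1 p'.2 t • V p'.1 p'.2) (Q p'.1 p'.2 t) y = 0 := by
  intro p p' hne y
  by_cases hy : meridian y ∈ closure (U p.1 p.2)
  · exact Or.inr (h.swirlField_eq_zero hF ht p' (hF.notMem_closure_of_mem hne.symm hy))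
  · exact Or.inl (h.swirlField_eq_zero hF ht p hy)

/-! ### Localisation: at most one summand is nonzero near each point -/

/-- **Localisation over `Ū_i^m`**: near a point `y` with `R⁻¹y ∈ Ū_i^m` the composite field IS the
`(i,m)` summand (the other closures are closed sets not containing `R⁻¹y`).
[cite: Scheffer1987, Lemma 3.2 (3.26)] [cite: Ozanski2017NSISingular, §6.3 Step 3] -/
theorem cprofileField_eventuallyEq_of_mem (hF : IsNSIStructureFamily U V f φ)
    (h : IsNSICantorProfileData U V f φ H T η δ ε C B Q) {t : ℝ} (ht : t ∈ Ioo (-η) (T + η))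
    (p : Fin 2 × A) {y : EuclideanSpace ℝ (Fin 3)} (hy : meridian y ∈ closure (U p.1 p.2)) :
    cprofileField V B Q t =ᶠ[𝓝 y] swirlField (B p.1 p.2 t • V p.1 p.2) (Q p.1 p.2 t) := by
  have hev : ∀ p' : Fin 2 × A, p' ≠ p → ∀ᶠ y' in 𝓝 y,
      swirlField (B p'.1 p'.2 t • V p'.1 p'.2) (Q p'.1 p'.2 t) y' = 0 := by
    intro p' hne
    have hO : IsOpen (revolve (closure (U p'.1 p'.2)))ᶜ :=
      (isClosed_closure.preimage continuous_meridian).isOpen_compl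
    filter_upwards [hO.mem_nhds (hF.notMem_closure_of_mem hne hy)] with y' hy'
    exact h.swirlField_eq_zero hF ht p' hy'
  have hall : ∀ᶠ y' in 𝓝 y, ∀ p' : Fin 2 × A, p' ≠ p →
      swirlField (B p'.1 p'.2 t • V p'.1 p'.2) (Q p'.1 p'.2 t) y' = 0 :=
    Filter.eventually_all.2 fun p' => by
      by_cases hne : p' = p
      · exact Filter.Eventually.of_forall fun y' h' => (h' hne).elim
      · exact (hev p' hne).mono fun y' hy' _ => hy'
  filter_upwards [hall] with y' hy'
  rw [cprofileField_apply]
  exact Finset.sum_eq_single p (fun p' _ hne => hy' p' hne) (fun hp => (hp (Finset.mem_univ p)).elim)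

/-- **Localisation off `⋃ R(Ū_i^m)`**: near such a point the composite field vanishes.
[cite: Scheffer1987, Lemma 3.2 (3.26)] -/
theorem cprofileField_eventuallyEq_zero (hF : IsNSIStructureFamily U V f φ)
    (h : IsNSICantorProfileData U V f φ H T η δ ε C B Q) {t : ℝ} (ht : t ∈ Ioo (-η) (T + η))
    {y : EuclideanSpace ℝ (Fin 3)} (hy : ∀ p : Fin 2 × A, meridian y ∉ closure (U p.1 p.2)) :
    cprofileField V B Q t =ᶠ[𝓝 y] fun _ => 0 := by
  have hall : ∀ᶠ y' in 𝓝 y, ∀ p : Fin 2 × A,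
      swirlField (B p.1 p.2 t • V p.1 p.2) (Q p.1 p.2 t) y' = 0 :=
    Filter.eventually_all.2 fun p => by
      have hO : IsOpen (revolve (closure (U p.1 p.2)))ᶜ :=
        (isClosed_closure.preimage continuous_meridian).isOpen_compl
      filter_upwards [hO.mem_nhds (hy p)] with y' hy'
      exact h.swirlField_eq_zero hF ht p hy'
  filter_upwards [hall] with y' hy'
  rw [cprofileField_apply]
  exact Finset.sum_eq_zero fun p _ => hy' p

/-- At a point over `Ū_i^m`, `v(x,t)` is the `(i,m)` summand. [cite: Scheffer1987, Lemma 3.2 (3.26)] -/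
theorem cprofileField_eq_of_mem (hF : IsNSIStructureFamily U V f φ)
    (h : IsNSICantorProfileData U V f φ H T η δ ε C B Q) {t : ℝ} (ht : t ∈ Ioo (-η) (T + η))
    (p : Fin 2 × A) {y : EuclideanSpace ℝ (Fin 3)} (hy : meridian y ∈ closure (U p.1 p.2)) :
    cprofileField V B Q t y = swirlField (B p.1 p.2 t • V p.1 p.2) (Q p.1 p.2 t) y :=
  (h.cprofileField_eventuallyEq_of_mem hF ht p hy).self_of_nhds

/-- Off `⋃ R(Ū_i^m)`, `v(x,t) = 0`. [cite: Scheffer1987, Lemma 3.2 (3.26)] -/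
theorem cprofileField_eq_zero (hF : IsNSIStructureFamily U V f φ)
    (h : IsNSICantorProfileData U V f φ H T η δ ε C B Q) {t : ℝ} (ht : t ∈ Ioo (-η) (T + η))
    {y : EuclideanSpace ℝ (Fin 3)} (hy : ∀ p : Fin 2 × A, meridian y ∉ closure (U p.1 p.2)) :
    cprofileField V B Q t y = 0 :=
  (h.cprofileField_eventuallyEq_zero hF ht hy).self_of_nhds

/-- Off the closure of `U_i^m` every OTHER profile vanishes at a point of it: for `q ∈ Ū_i^m`,
`Q_{i'}^{m'}(t)(q) = 0`, `(i',m') ≠ (i,m)`. [cite: Scheffer1987, Lemma 3.2 (3.18)] -/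
theorem Q_eq_zero_of_mem (hF : IsNSIStructureFamily U V f φ)
    (h : IsNSICantorProfileData U V f φ H T η δ ε C B Q) {t : ℝ} (ht : t ∈ Ioo (-η) (T + η))
    {p p' : Fin 2 × A} (hne : p' ≠ p) {q : ℝ × ℝ} (hq : q ∈ closure (U p.1 p.2)) :
    Q p'.1 p'.2 t q = 0 :=
  h.Q_eq_zero p'.1 p'.2 t ht q (hF.notMem_closure_of_mem hne hq)

/-! ### Smoothness, norm, support, divergence -/

/-- **`v ∈ C^∞` on the open slab** (sum of jointly smooth swirl fields; Ożański Prop. 16: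
`v^{(j)} ∈ C^∞(ℝ³ × [0,T])`). [cite: Ozanski2017NSISingular, Prop. 16 and §6.3 Step 2] -/
theorem isSmoothSpaceTimeOn_cprofileField (hF : IsNSIStructureFamily U V f φ)
    (h : IsNSICantorProfileData U V f φ H T η δ ε C B Q) :
    IsSmoothSpaceTimeOn (Ioo (-η) (T + η)) (cprofileField V B Q) := by
  have hterm : ∀ p : Fin 2 × A, IsSmoothSpaceTimeOn (Ioo (-η) (T + η))
      fun t x => swirlField (B p.1 p.2 t • V p.1 p.2) (Q p.1 p.2 t) x := fun p =>
    isSmoothSpaceTimeOn_swirlField_param (hF.isNSIStructure p.1 p.2).isCompact_closure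
      (hF.isNSIStructure p.1 p.2).closure_subset (hF.isNSIStructure p.1 p.2).v_smooth
      ((h.tsupport_V p.1 p.2).trans (h.subset p.1 p.2)) (h.B_smooth p.1 p.2) (h.abs_B_le p.1 p.2)
      (h.Q_smooth p.1 p.2) (h.Q_nonneg p.1 p.2) (h.Q_eq_zero p.1 p.2) (h.sq_lt p.1 p.2)
  have e : uncurry (cprofileField V B Q) = fun z : ℝ × EuclideanSpace ℝ (Fin 3) =>
      ∑ p : Fin 2 × A, swirlField (B p.1 p.2 z.1 • V p.1 p.2) (Q p.1 p.2 z.1) z.2 := by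
    funext z; rfl
  show ContDiffOn ℝ ∞ (uncurry (cprofileField V B Q)) _
  rw [e]
  exact ContDiffOn.sum fun p _ => hterm p

/-- Each slice `v(t)`, `t ∈ J`, is smooth. [cite: Ozanski2017NSISingular, Prop. 16] -/
theorem contDiff_cprofileField (hF : IsNSIStructureFamily U V f φ)
    (h : IsNSICantorProfileData U V f φ H T η δ ε C B Q) {t : ℝ} (ht : t ∈ Ioo (-η) (T + η)) :
    ContDiff ℝ ∞ (cprofileField V B Q t) :=
  (h.isSmoothSpaceTimeOn_cprofileField hF).contDiff_slice ht

/-- **`|v(x,t)| = Σ_{(i,m)} Q_i^m(t)(R⁻¹x)`** for `t ∈ J` (at most one term is nonzero at each point;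
Ożański §6.3 Step 3: "`|v(x,t)| = Σ_𝔪 |q_{1,t}^{𝔪,k}(R⁻¹x) + q_{2,t}^{𝔪,k}(R⁻¹x)|`").
[cite: Ozanski2017NSISingular, §6.3 Step 3 ((iv))] -/
theorem norm_cprofileField (hF : IsNSIStructureFamily U V f φ)
    (h : IsNSICantorProfileData U V f φ H T η δ ε C B Q) {t : ℝ} (ht : t ∈ Ioo (-η) (T + η))
    (x : EuclideanSpace ℝ (Fin 3)) :
    ‖cprofileField V B Q t x‖ = ∑ p : Fin 2 × A, Q p.1 p.2 t (meridian x) := by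
  by_cases hx : ∃ p : Fin 2 × A, meridian x ∈ closure (U p.1 p.2)
  · obtain ⟨p, hp⟩ := hx
    rw [h.cprofileField_eq_of_mem hF ht p hp, (h.slice hF p.1 p.2 ht).norm_swirlField_eq x]
    exact (Finset.sum_eq_single (f := fun p' : Fin 2 × A => Q p'.1 p'.2 t (meridian x)) p
      (fun p' _ hne => h.Q_eq_zero_of_mem hF ht hne hp) (fun hp' => (hp' (Finset.mem_univ p)).elim)).symm
  · push Not at hx
    rw [h.cprofileField_eq_zero hF ht hx, norm_zero]
    exact (Finset.sum_eq_zero fun p _ => h.Q_eq_zero p.1 p.2 t ht _ (hx p)).symm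

/-- **`|v(x,t)|² = Σ_{(i,m)} Q_i^m(t)(R⁻¹x)²`** for `t ∈ J`. [cite: Ozanski2017NSISingular, §6.3 Step 3] -/
theorem norm_sq_cprofileField (hF : IsNSIStructureFamily U V f φ)
    (h : IsNSICantorProfileData U V f φ H T η δ ε C B Q) {t : ℝ} (ht : t ∈ Ioo (-η) (T + η))
    (x : EuclideanSpace ℝ (Fin 3)) :
    ‖cprofileField V B Q t x‖ ^ 2 = ∑ p : Fin 2 × A, Q p.1 p.2 t (meridian x) ^ 2 := by
  by_cases hx : ∃ p : Fin 2 × A, meridian x ∈ closure (U p.1 p.2)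
  · obtain ⟨p, hp⟩ := hx
    rw [h.cprofileField_eq_of_mem hF ht p hp, (h.slice hF p.1 p.2 ht).norm_swirlField_eq x]
    exact (Finset.sum_eq_single (f := fun p' : Fin 2 × A => Q p'.1 p'.2 t (meridian x) ^ 2) p
      (fun p' _ hne => by simp only [h.Q_eq_zero_of_mem hF ht hne hp]; ring)
      (fun hp' => (hp' (Finset.mem_univ p)).elim)).symm
  · push Not at hx
    rw [h.cprofileField_eq_zero hF ht hx, norm_zero]
    symm
    rw [zero_pow two_ne_zero]
    exact Finset.sum_eq_zero fun p _ => by simp only [h.Q_eq_zero p.1 p.2 t ht _ (hx p)]; ring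

/-- **`supp v(t) ⊆ ⋃ R(Ū_i^m)`** for `t ∈ J` (Prop. 16 (i): `supp v^{(j)}(t) = R(supp h_t^{(j)})`).
[cite: Ozanski2017NSISingular, Prop. 16 (i)] -/
theorem tsupport_cprofileField_subset (hF : IsNSIStructureFamily U V f φ)
    (h : IsNSICantorProfileData U V f φ H T η δ ε C B Q) {t : ℝ} (ht : t ∈ Ioo (-η) (T + η)) :
    tsupport (cprofileField V B Q t) ⊆ ⋃ p : Fin 2 × A, revolve (closure (U p.1 p.2)) := by
  refine closure_minimal (fun y hy => ?_) (IsNSIStructureFamily.isClosed_iUnion_revolve U)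
  by_contra hy'
  have hy'' : ∀ p : Fin 2 × A, meridian y ∉ closure (U p.1 p.2) := fun p hp =>
    hy' (mem_iUnion.2 ⟨p, hp⟩)
  exact hy (h.cprofileField_eq_zero hF ht hy'')

/-- `v(t)` has compact support. [cite: Ozanski2017NSISingular, Prop. 16 (i)] -/
theorem hasCompactSupport_cprofileField (hF : IsNSIStructureFamily U V f φ)
    (h : IsNSICantorProfileData U V f φ H T η δ ε C B Q) {t : ℝ} (ht : t ∈ Ioo (-η) (T + η)) :
    HasCompactSupport (cprofileField V B Q t) :=
  hF.isCompact_iUnion_revolve.of_isClosed_subset (isClosed_tsupport _) (h.tsupport_cprofileField_subset hF ht)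

/-- **`div v(t) = 0`** for `t ∈ J` (locally a single divergence-free swirl field, or zero).
[cite: Ozanski2017NSISingular, Prop. 16 (i)] -/
theorem isDivFree_cprofileField (hF : IsNSIStructureFamily U V f φ)
    (h : IsNSICantorProfileData U V f φ H T η δ ε C B Q) {t : ℝ} (ht : t ∈ Ioo (-η) (T + η)) :
    VectorCalculus.IsDivFree (cprofileField V B Q t) := by
  intro x
  by_cases hx : ∃ p : Fin 2 × A, meridian x ∈ closure (U p.1 p.2)
  · obtain ⟨p, hp⟩ := hx
    have hloc := h.cprofileField_eventuallyEq_of_mem hF ht p hp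
    rw [VectorCalculus.divergence, hloc.fderiv_eq]
    exact (h.slice hF p.1 p.2 ht).isDivFree_swirlField x
  · push Not at hx
    have hloc := h.cprofileField_eventuallyEq_zero hF ht hx
    rw [VectorCalculus.divergence, hloc.fderiv_eq]
    simp

/-! ### The pressure (6.24) -/

/-- The composite field is axisymmetric. [cite: Ozanski2017NSISingular, §3.3 (3.10)–(3.12)] -/
theorem isAxisymmetric_cprofileField (V : Fin 2 → A → ℝ × ℝ → ℝ × ℝ) (B : Fin 2 → A → ℝ → ℝ)
    (Q : Fin 2 → A → ℝ → ℝ × ℝ → ℝ) (t : ℝ) : IsAxisymmetric (cprofileField V B Q t) := by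
  intro θ x
  rw [cprofileField_apply, cprofileField_apply]
  calc ∑ p : Fin 2 × A, swirlField (B p.1 p.2 t • V p.1 p.2) (Q p.1 p.2 t) (rotZ θ x)
      = ∑ p : Fin 2 × A, rotZ θ (swirlField (B p.1 p.2 t • V p.1 p.2) (Q p.1 p.2 t) x) :=
        Finset.sum_congr rfl fun p _ => isAxisymmetric_swirlField _ _ θ x
    _ = ∑ p : Fin 2 × A, rotZLIE θ (swirlField (B p.1 p.2 t • V p.1 p.2) (Q p.1 p.2 t) x) :=
        Finset.sum_congr rfl fun p _ => (rotZLIE_apply θ _).symm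
    _ = rotZLIE θ (∑ p : Fin 2 × A, swirlField (B p.1 p.2 t • V p.1 p.2) (Q p.1 p.2 t) x) :=
        (map_sum (rotZLIE θ) _ _).symm
    _ = rotZ θ (∑ p : Fin 2 × A, swirlField (B p.1 p.2 t • V p.1 p.2) (Q p.1 p.2 t) x) :=
        rotZLIE_apply θ _

/-- The pressure of the composite field is an axisymmetric scalar. [cite: Ozanski2017NSISingular, §3.2 (3.8)] -/
theorem isAxisymmetricScalar_normalisedPressure_cprofileField (V : Fin 2 → A → ℝ × ℝ → ℝ × ℝ)
    (B : Fin 2 → A → ℝ → ℝ) (Q : Fin 2 → A → ℝ → ℝ × ℝ → ℝ) (t : ℝ) :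
    IsAxisymmetricScalar (normalisedPressure (cprofileField V B Q t)) := fun θ x =>
  normalisedPressure_comp_linearIsometryEquiv_of_equivariant (rotZLIE θ)
    (fun y => isAxisymmetric_cprofileField V B Q t θ y) x

/-- **(6.24): `p̄(t) = Σ_{(i,m)} p*[B_i^m(t)V_i^m, Q_i^m(t)]`** for `t ∈ J` (Ożański Lemma 3.2 (iii)
iterated over the pairwise disjointly supported summands).
[cite: Ozanski2017NSISingular, §6.3 (6.24) and Lemma 3.2 (iii)] -/
theorem normalisedPressure_cprofileField (hF : IsNSIStructureFamily U V f φ)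
    (h : IsNSICantorProfileData U V f φ H T η δ ε C B Q) {t : ℝ} (ht : t ∈ Ioo (-η) (T + η)) :
    normalisedPressure (cprofileField V B Q t) =
      ∑ p : Fin 2 × A, normalisedPressure (swirlField (B p.1 p.2 t • V p.1 p.2) (Q p.1 p.2 t)) := by
  have e : cprofileField V B Q t =
      ∑ p : Fin 2 × A, swirlField (B p.1 p.2 t • V p.1 p.2) (Q p.1 p.2 t) := by
    funext x; rw [cprofileField_apply, Finset.sum_apply]
  rw [e]
  exact normalisedPressure_sum_of_pairwise_disjoint_of_contDiff _ (h.swirlField_eq_zero_or hF ht)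
    (fun p => contDiff_infty.1 (h.slice hF p.1 p.2 ht).contDiff_swirlField 1)
    fun p => lintegral_enorm_sq_lt_top_of_hasCompactSupport
      (h.slice hF p.1 p.2 ht).contDiff_swirlField.continuous
      (h.slice hF p.1 p.2 ht).hasCompactSupport_swirlField

/-- **The planar trace of the pressure**:
`p̄(t)(r,0,z) = Σ_lΣ_n p[B_l^n V_l^n, Q_l^n](r,z)` (Ożański, after (6.24)).
[cite: Ozanski2017NSISingular, §6.3 (after (6.24))] -/
theorem normalisedPressure_cprofileField_meridianPoint (hF : IsNSIStructureFamily U V f φ)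
    (h : IsNSICantorProfileData U V f φ H T η δ ε C B Q) {t : ℝ} (ht : t ∈ Ioo (-η) (T + η))
    (q : ℝ × ℝ) :
    normalisedPressure (cprofileField V B Q t) (meridianPoint q) =
      ∑ l, ∑ n, planePressure (B l n t • V l n) (Q l n t) q := by
  rw [h.normalisedPressure_cprofileField hF ht, Finset.sum_apply, Fintype.sum_prod_type]
  rfl

/-- `p̄(t) ∈ C^∞` for `t ∈ J`. [cite: Ozanski2017NSISingular, §3.3 (3.21)] -/
theorem contDiff_normalisedPressure_cprofileField (hF : IsNSIStructureFamily U V f φ)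
    (h : IsNSICantorProfileData U V f φ H T η δ ε C B Q) {t : ℝ} (ht : t ∈ Ioo (-η) (T + η)) :
    ContDiff ℝ ∞ (normalisedPressure (cprofileField V B Q t)) :=
  contDiff_normalisedPressure_of_contDiff_infty (h.contDiff_cprofileField hF ht)
    (h.hasCompactSupport_cprofileField hF ht)

/-! ### The scalar `|v|² + 2p̄` -/

/-- `|v(t)|² + 2p̄(t)` is axisymmetric. [cite: Ozanski2017NSISingular, §3.2 (3.8)] -/
theorem isAxisymmetricScalar_energyPressure (hF : IsNSIStructureFamily U V f φ)
    (h : IsNSICantorProfileData U V f φ H T η δ ε C B Q) {t : ℝ} (ht : t ∈ Ioo (-η) (T + η)) :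
    IsAxisymmetricScalar fun y => ‖cprofileField V B Q t y‖ ^ 2 +
      2 * normalisedPressure (cprofileField V B Q t) y := by
  intro θ y
  have hp := isAxisymmetricScalar_normalisedPressure_cprofileField V B Q t θ y
  simp only
  rw [h.norm_sq_cprofileField hF ht, h.norm_sq_cprofileField hF ht, meridian_rotZ, hp]

/-- `|v(t)|² + 2p̄(t)` is differentiable. [folklore] -/
theorem differentiable_energyPressure (hF : IsNSIStructureFamily U V f φ)
    (h : IsNSICantorProfileData U V f φ H T η δ ε C B Q) {t : ℝ} (ht : t ∈ Ioo (-η) (T + η)) :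
    Differentiable ℝ fun y => ‖cprofileField V B Q t y‖ ^ 2 +
      2 * normalisedPressure (cprofileField V B Q t) y :=
  (((h.contDiff_cprofileField hF ht).differentiable (by simp)).norm_sq ℝ).add
    (((h.contDiff_normalisedPressure_cprofileField hF ht).differentiable (by simp)).const_mul 2)

/-- **The planar trace of `|v|² + 2p̄` near a point of `U_i^m`** is the planar potential
`(Q_i^m)² + 2Σ_{l,n} p[B_l^nV_l^n, Q_l^n]` (all other profiles vanish on `U_i^m`).
[cite: Ozanski2017NSISingular, §6.3 Step 3 (Case 2)] [cite: Scheffer1987, Lemma 3.2 (3.36)–(3.38)] -/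
theorem energyPressure_meridianPoint_eventuallyEq (hF : IsNSIStructureFamily U V f φ)
    (h : IsNSICantorProfileData U V f φ H T η δ ε C B Q) {t : ℝ} (ht : t ∈ Ioo (-η) (T + η))
    {i : Fin 2} {m : A} {q : ℝ × ℝ} (hq : q ∈ U i m) :
    (fun q' => ‖cprofileField V B Q t (meridianPoint q')‖ ^ 2 +
        2 * normalisedPressure (cprofileField V B Q t) (meridianPoint q')) =ᶠ[𝓝 q]
      cprofilePotential V B Q i m t := by
  have hS := hF.isNSIStructure i m
  have hq1 : 0 < q.1 := hS.subset_halfPlane hq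
  filter_upwards [(isOpen_lt continuous_const continuous_fst).mem_nhds hq1, hS.isOpen.mem_nhds hq]
    with q' hq' hq'U
  have hcl : q' ∈ closure (U i m) := subset_closure hq'U
  rw [h.norm_sq_cprofileField hF ht, h.normalisedPressure_cprofileField_meridianPoint hF ht,
    meridian_meridianPoint (le_of_lt hq'), cprofilePotential,
    Finset.sum_eq_single (f := fun p' : Fin 2 × A => Q p'.1 p'.2 t q' ^ 2) (i, m) (fun p' _ hne => by
      simp only [h.Q_eq_zero_of_mem hF ht (p := (i, m)) hne hcl]; ring)
      (fun hp => (hp (Finset.mem_univ _)).elim)]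

/-! ### The transport term -/

/-- **The transport term over `U_i^m`** (Case 2 of Step 3): for `t ∈ J` and `R⁻¹x = q ∈ U_i^m`,
`v·∇(|v|² + 2p̄)(x,t) = B_i^m(t) V_i^m(q)·∇(cprofilePotential_i^m(t))(q)`.
[cite: Ozanski2017NSISingular, §6.3 Step 3 (Case 2)] [cite: Scheffer1987, Lemma 3.2 (3.39)] -/
theorem inner_gradient_energyPressure (hF : IsNSIStructureFamily U V f φ)
    (h : IsNSICantorProfileData U V f φ H T η δ ε C B Q) {t : ℝ} (ht : t ∈ Ioo (-η) (T + η))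
    {i : Fin 2} {m : A} {x : EuclideanSpace ℝ (Fin 3)} (hx : meridian x ∈ U i m) :
    ⟪cprofileField V B Q t x,
        gradient (fun y => ‖cprofileField V B Q t y‖ ^ 2 +
          2 * normalisedPressure (cprofileField V B Q t) y) x⟫ =
      B i m t * (V i m (meridian x)).1 * derivR (cprofilePotential V B Q i m t) (meridian x) +
        B i m t * (V i m (meridian x)).2 * derivZ (cprofilePotential V B Q i m t) (meridian x) := by
  have hS := hF.isNSIStructure i m
  have hq1 : 0 < (meridian x).1 := hS.subset_halfPlane hx
  have hxr : cylRadius x ≠ 0 := hq1.ne'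
  have hloc := h.energyPressure_meridianPoint_eventuallyEq hF ht hx
  rw [h.cprofileField_eq_of_mem hF ht (i, m) (subset_closure hx),
    inner_swirlField_gradient (h.isAxisymmetricScalar_energyPressure hF ht) _ _ hxr
      (h.differentiable_energyPressure hF ht x), derivR, derivZ, hloc.fderiv_eq]
  simp only [Pi.smul_apply, Prod.smul_fst, Prod.smul_snd, smul_eq_mul, derivR, derivZ, mul_assoc]

/-- **The transport term vanishes off `⋃ R(C_i^m)`** (Case 1 of Step 3; (3.30)): for `t ∈ J` and
`R⁻¹x ∉ C_i^m` for all `(i,m)` (so all `V_i^m(R⁻¹x) = 0`), `v·∇(|v|² + 2p̄)(x,t) = 0`.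
[cite: Ozanski2017NSISingular, §6.3 Step 3 (Case 1) and §3.4 (3.30)] -/
theorem inner_gradient_energyPressure_eq_zero (hF : IsNSIStructureFamily U V f φ)
    (h : IsNSICantorProfileData U V f φ H T η δ ε C B Q) {t : ℝ} (ht : t ∈ Ioo (-η) (T + η))
    {x : EuclideanSpace ℝ (Fin 3)} (hx : ∀ p : Fin 2 × A, meridian x ∉ C p.1 p.2) :
    ⟪cprofileField V B Q t x,
        gradient (fun y => ‖cprofileField V B Q t y‖ ^ 2 +
          2 * normalisedPressure (cprofileField V B Q t) y) x⟫ = 0 := by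
  have hax := h.isAxisymmetricScalar_energyPressure hF ht
  rw [cprofileField_apply, sum_inner]
  refine Finset.sum_eq_zero fun p _ => ?_
  have hv : (B p.1 p.2 t • V p.1 p.2) (meridian x) = 0 := by
    rw [Pi.smul_apply, image_eq_zero_of_notMem_tsupport fun h' => hx p (h.tsupport_V p.1 p.2 h'),
      smul_zero]
  exact inner_swirlField_gradient_eq_zero hax _ _ hv

/-! ### The viscous term -/

/-- **`v·Δv ≥ 0` off `⋃ R(C_i^m)`** for `t ∈ [0,T]` (Case 1 of Step 3 with (3.24): near `x` the
field is a single summand `u[0, Q_i^m(t)]` with `⟨u, Δu⟩ = Q L(Q) ∘ R⁻¹ ≥ 0`, or vanishes).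
[cite: Ozanski2017NSISingular, §6.3 Step 3 (Case 1) and §3.4 (3.24)] [cite: Scheffer1987, Lemma 3.2 (3.22)] -/
theorem inner_laplacian_cprofileField_nonneg (hF : IsNSIStructureFamily U V f φ)
    (h : IsNSICantorProfileData U V f φ H T η δ ε C B Q) {t : ℝ} (ht : t ∈ Icc (0 : ℝ) T)
    {x : EuclideanSpace ℝ (Fin 3)} (hx : ∀ p : Fin 2 × A, meridian x ∉ C p.1 p.2) :
    0 ≤ ⟪cprofileField V B Q t x, (Δ (cprofileField V B Q t)) x⟫ := by
  have htJ := h.Icc_subset ht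
  by_cases hx' : ∃ p : Fin 2 × A, meridian x ∈ closure (U p.1 p.2)
  · obtain ⟨p, hp⟩ := hx'
    have hloc := h.cprofileField_eventuallyEq_of_mem hF htJ p hp
    have hr : cylRadius x ≠ 0 := ne_of_gt ((hF.isNSIStructure p.1 p.2).closure_subset hp)
    have hq : meridian x ∉ tsupport (B p.1 p.2 t • V p.1 p.2) := fun h' =>
      hx p (h.tsupport_V p.1 p.2 (tsupport_smul_subset_right (fun _ => B p.1 p.2 t) (V p.1 p.2) h'))
    rw [(InnerProductSpace.laplacian_congr_nhds hloc).self_of_nhds, hloc.self_of_nhds,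
      (h.slice hF p.1 p.2 htJ).inner_swirlField_laplacian_eq hr hq]
    exact h.opL p.1 p.2 t ht _ (hx p) ((hF.isNSIStructure p.1 p.2).closure_subset hp)
  · push Not at hx'
    rw [h.cprofileField_eq_zero hF htJ hx', inner_zero_left]

/-- At every point `v·Δv` is the `(i,m)`-summand's `u·Δu` (over `Ū_i^m`) or `0`. [folklore] -/
theorem inner_laplacian_cprofileField_eq (hF : IsNSIStructureFamily U V f φ)
    (h : IsNSICantorProfileData U V f φ H T η δ ε C B Q) {t : ℝ} (ht : t ∈ Ioo (-η) (T + η))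
    (p : Fin 2 × A) {x : EuclideanSpace ℝ (Fin 3)} (hx : meridian x ∈ closure (U p.1 p.2)) :
    ⟪cprofileField V B Q t x, (Δ (cprofileField V B Q t)) x⟫ =
      ⟪swirlField (B p.1 p.2 t • V p.1 p.2) (Q p.1 p.2 t) x,
        (Δ (swirlField (B p.1 p.2 t • V p.1 p.2) (Q p.1 p.2 t))) x⟫ := by
  have hloc := h.cprofileField_eventuallyEq_of_mem hF ht p hx
  rw [(InnerProductSpace.laplacian_congr_nhds hloc).self_of_nhds, hloc.self_of_nhds]

/-- Off `⋃ R(Ū_i^m)`, `v·Δv = 0`. [folklore] -/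
theorem inner_laplacian_cprofileField_eq_zero (hF : IsNSIStructureFamily U V f φ)
    (h : IsNSICantorProfileData U V f φ H T η δ ε C B Q) {t : ℝ} (ht : t ∈ Ioo (-η) (T + η))
    {x : EuclideanSpace ℝ (Fin 3)} (hx : ∀ p : Fin 2 × A, meridian x ∉ closure (U p.1 p.2)) :
    ⟪cprofileField V B Q t x, (Δ (cprofileField V B Q t)) x⟫ = 0 := by
  rw [h.cprofileField_eq_zero hF ht hx, inner_zero_left]

/-! ### The time derivative of `|v|²` -/

/-- Each time line `s ↦ Q_i^m(s)(q)` is differentiable at `t ∈ J`. [folklore] -/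
theorem differentiableAt_Q (h : IsNSICantorProfileData U V f φ H T η δ ε C B Q) (i : Fin 2) (m : A)
    {t : ℝ} (ht : t ∈ Ioo (-η) (T + η)) (q : ℝ × ℝ) :
    DifferentiableAt ℝ (fun s => Q i m s q) t :=
  ((IsSmoothSpaceTimeOn.hasDerivWithinAt_time (h.Q_smooth i m) ht q).hasDerivAt
    (Ioo_mem_nhds ht.1 ht.2)).differentiableAt

/-- **`∂ₜ|v|²(x,t) = Σ_{(i,m)} ∂ₜ(Q_i^m)²(t, R⁻¹x)`** for `t ∈ J`.
[cite: Ozanski2017NSISingular, §6.3 Step 3 (Cases 1–2)] [cite: Scheffer1987, Lemma 3.2 (3.36)] -/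
theorem timeDeriv_norm_sq_cprofileField (hF : IsNSIStructureFamily U V f φ)
    (h : IsNSICantorProfileData U V f φ H T η δ ε C B Q) {t : ℝ} (ht : t ∈ Ioo (-η) (T + η))
    (x : EuclideanSpace ℝ (Fin 3)) :
    timeDeriv (fun s y => ‖cprofileField V B Q s y‖ ^ 2) t x =
      ∑ p : Fin 2 × A, deriv (fun s => Q p.1 p.2 s (meridian x) ^ 2) t := by
  rw [timeDeriv_apply]
  have he : (fun s => ‖cprofileField V B Q s x‖ ^ 2) =ᶠ[𝓝 t]
      fun s => ∑ p : Fin 2 × A, Q p.1 p.2 s (meridian x) ^ 2 := by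
    filter_upwards [Ioo_mem_nhds ht.1 ht.2] with s hs
    exact h.norm_sq_cprofileField hF hs x
  rw [he.deriv_eq]
  have hd : ∀ p : Fin 2 × A, DifferentiableAt ℝ (fun s => Q p.1 p.2 s (meridian x) ^ 2) t := fun p =>
    (h.differentiableAt_Q p.1 p.2 ht _).pow 2
  exact deriv_fun_sum fun p _ => hd p

/-- Off `Ū_i^m` the `(i,m)` profile is frozen: `∂ₜ(Q_i^m)²(t,q) = 0` for `q ∉ Ū_i^m`, `t ∈ J`.
[cite: Scheffer1987, Lemma 3.2 (3.18)] -/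
theorem deriv_Q_sq_eq_zero (h : IsNSICantorProfileData U V f φ H T η δ ε C B Q) (i : Fin 2) (m : A)
    {t : ℝ} (ht : t ∈ Ioo (-η) (T + η)) {q : ℝ × ℝ} (hq : q ∉ closure (U i m)) :
    deriv (fun s => Q i m s q ^ 2) t = 0 := by
  have he : (fun s => Q i m s q ^ 2) =ᶠ[𝓝 t] fun _ => (0 : ℝ) := by
    filter_upwards [Ioo_mem_nhds ht.1 ht.2] with s hs
    rw [h.Q_eq_zero i m s hs q hq]
    simp
  rw [he.deriv_eq, deriv_const]

/-! ### The Navier–Stokes inequality (Proposition 16 (iii)) -/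

/-- **Proposition 16 (iii) for the composite field, given a lower bound on `v·Δv`.** If
`⟨v, Δv⟩ ≥ -M_L` on `[0,T] × ℝ³`, then for every `ν ∈ [0, δ/(2M_L + 1)]` the pointwise Navier–Stokes
inequality `∂ₜ|v|² ≤ -v·∇(|v|² + 2p̄) + 2ν v·Δv` holds on `[0,T] × ℝ³` — by the printed case analysis
at `q = R⁻¹x`: `q ∈ C_i^m` (Case 2): `∂ₜ|v|² = ∂ₜ(Q_i^m)² ≤ -δ - B v·∇Φ = -δ - v·∇(|v|² + 2p̄) ≤
-v·∇(|v|² + 2p̄) + 2ν v·Δv` since `2ν M_L ≤ δ`; `q ∉ ⋃ C_i^m` (Case 1): `∂ₜ|v|² ≤ 0 ≤ 2ν v·Δv` and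
the transport term vanishes (Ożański §6.3 Step 3 with (6.26); Scheffer 1987, Lemma 3.2).
[cite: Ozanski2017NSISingular, §6.3 Step 3 (Cases 1–2, (6.26))] [cite: Scheffer1987, Lemma 3.2] -/
theorem nsi_cprofileField (hF : IsNSIStructureFamily U V f φ)
    (h : IsNSICantorProfileData U V f φ H T η δ ε C B Q) {ML : ℝ} (hML : 0 ≤ ML)
    (hlow : ∀ t ∈ Icc (0 : ℝ) T, ∀ x : EuclideanSpace ℝ (Fin 3),
      -ML ≤ ⟪cprofileField V B Q t x, (Δ (cprofileField V B Q t)) x⟫)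
    {ν : ℝ} (hν : ν ∈ Icc (0 : ℝ) (δ / (2 * ML + 1))) {t : ℝ} (ht : t ∈ Icc (0 : ℝ) T)
    (x : EuclideanSpace ℝ (Fin 3)) :
    timeDeriv (fun r y => ‖cprofileField V B Q r y‖ ^ 2) t x ≤
      -⟪cprofileField V B Q t x, gradient (fun y => ‖cprofileField V B Q t y‖ ^ 2 +
          2 * normalisedPressure (cprofileField V B Q t) y) x⟫ +
        2 * ν * ⟪cprofileField V B Q t x, (Δ (cprofileField V B Q t)) x⟫ := by
  have htJ := h.Icc_subset ht
  have hν₀ : 0 < δ / (2 * ML + 1) := div_pos h.δ_pos (by linarith)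
  set L := ⟪cprofileField V B Q t x, (Δ (cprofileField V B Q t)) x⟫ with hLdef
  -- the slack absorbs the viscous term: `2ν M_L ≤ δ`
  have hvisc : -δ ≤ 2 * ν * L := by
    have h1 : ν * ML ≤ δ / (2 * ML + 1) * ML := mul_le_mul_of_nonneg_right hν.2 hML
    have h2 : δ / (2 * ML + 1) * ML * 2 ≤ δ := by
      rw [div_mul_eq_mul_div, div_mul_eq_mul_div, div_le_iff₀ (by linarith)]
      nlinarith [h.δ_pos]
    have h3 : ν * -ML ≤ ν * L := mul_le_mul_of_nonneg_left (hlow t ht x) hν.1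
    nlinarith
  rw [h.timeDeriv_norm_sq_cprofileField hF htJ x]
  by_cases hC : ∃ p : Fin 2 × A, meridian x ∈ C p.1 p.2
  · -- Case 2 over `U_i^m`
    obtain ⟨⟨i, m⟩, hq⟩ := hC
    have hU : meridian x ∈ U i m := h.subset i m hq
    have hcl : meridian x ∈ closure (U i m) := subset_closure hU
    rw [Finset.sum_eq_single (i, m) (fun p' _ hne =>
        h.deriv_Q_sq_eq_zero p'.1 p'.2 htJ (hF.notMem_closure_of_mem (p := (i, m)) hne hcl))
      (fun hp => (hp (Finset.mem_univ _)).elim),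
      h.inner_gradient_energyPressure hF htJ hU]
    have hin := h.inner i m t ht _ hq
    linarith
  · -- Case 1: off `⋃ R(C_i^m)`
    push Not at hC
    rw [h.inner_gradient_energyPressure_eq_zero hF htJ hC, neg_zero, zero_add]
    have h1 : ∑ p : Fin 2 × A, deriv (fun s => Q p.1 p.2 s (meridian x) ^ 2) t ≤ 0 :=
      Finset.sum_nonpos fun p _ => h.outer p.1 p.2 t ht _ (hC p)
    have h3 : 0 ≤ L := h.inner_laplacian_cprofileField_nonneg hF ht hC
    have h4 : 0 ≤ 2 * ν * L := mul_nonneg (mul_nonneg two_pos.le hν.1) h3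
    linarith

/-! ### Initial values and closeness to the limit profiles (Proposition 16 (ii)) -/

/-- **`|v(x,0)| = Σ_{(i,m)} f_i^m(R⁻¹x)`** (Prop. 16 (ii): `|v^{(j)}(x,0)| = h₀^{(j)}(R⁻¹x)`).
[cite: Ozanski2017NSISingular, Prop. 16 (ii)] -/
theorem norm_cprofileField_zero (hF : IsNSIStructureFamily U V f φ)
    (h : IsNSICantorProfileData U V f φ H T η δ ε C B Q) (hT : 0 < T) (x : EuclideanSpace ℝ (Fin 3)) :
    ‖cprofileField V B Q 0 x‖ = ∑ p : Fin 2 × A, f p.1 p.2 (meridian x) := by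
  rw [h.norm_cprofileField hF (h.Icc_subset ⟨le_rfl, hT.le⟩) x]
  exact Finset.sum_congr rfl fun p _ => h.initial p.1 p.2 _

/-- **`||v(x,t)|² - Σ (H_i^m)²(t,R⁻¹x)| ≤ ε`** for `t ∈ [0,T]` (Prop. 16 (ii) from (6.22): at most one
pair of the sum is nonzero at each point, and `|(Q)² - (H)²| ≤ ε` termwise; off `⋃ Ū_i^m` both
sides vanish provided `H_i^m(t) = 0` off `Ū_i^m`).
[cite: Ozanski2017NSISingular, Prop. 16 (ii) and §6.3 (6.22)] -/
theorem abs_norm_sq_sub_le (hF : IsNSIStructureFamily U V f φ)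
    (h : IsNSICantorProfileData U V f φ H T η δ ε C B Q)
    (hHz : ∀ i m t, ∀ q ∉ closure (U i m), H i m t q = 0) {t : ℝ} (ht : t ∈ Icc (0 : ℝ) T)
    (x : EuclideanSpace ℝ (Fin 3)) :
    |‖cprofileField V B Q t x‖ ^ 2 - ∑ p : Fin 2 × A, H p.1 p.2 t (meridian x) ^ 2| ≤ ε := by
  have htJ := h.Icc_subset ht
  rw [h.norm_sq_cprofileField hF htJ x, ← Finset.sum_sub_distrib]
  by_cases hx : ∃ p : Fin 2 × A, meridian x ∈ closure (U p.1 p.2)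
  · obtain ⟨p, hp⟩ := hx
    rw [Finset.sum_eq_single (f := fun p' : Fin 2 × A =>
        Q p'.1 p'.2 t (meridian x) ^ 2 - H p'.1 p'.2 t (meridian x) ^ 2) p (fun p' _ hne => by
      simp only [h.Q_eq_zero_of_mem hF htJ hne hp,
        hHz p'.1 p'.2 t _ (hF.notMem_closure_of_mem hne hp)]
      ring) (fun hp' => (hp' (Finset.mem_univ p)).elim)]
    exact h.close₀ p.1 p.2 t ht _
  · push Not at hx
    rw [Finset.sum_eq_zero fun p _ => by
      simp only [h.Q_eq_zero p.1 p.2 t htJ _ (hx p), hHz p.1 p.2 t _ (hx p)]; ring, abs_zero]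
    exact h.ε_nonneg

/-! ### Energy and dissipation of a slice against pointwise bounds (Proposition 16 (iv)) -/

/-- **The energy of a slice** against a pointwise bound of the profiles: if `(Q_i^m(t))² ≤ S`
everywhere, then `∫ |v(t)|² ≤ S · Σ_{(i,m)} |R(Ū_i^m)|` (Ożański §6.3 Step 3: "`|v| ≤ 𝒞`",
"since `supp v(t)` consists of `𝔐` copies of `R(Ū₁ ∪ Ū₂)` … `‖v(t)‖ ≤ 𝔐𝒞`").
[cite: Ozanski2017NSISingular, §6.3 Step 3 ((iv), energy)] -/
theorem lintegral_enorm_sq_cprofileField_le (hF : IsNSIStructureFamily U V f φ)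
    (h : IsNSICantorProfileData U V f φ H T η δ ε C B Q) {t : ℝ} (ht : t ∈ Ioo (-η) (T + η))
    {S : ℝ} (hS : ∀ i m q, Q i m t q ^ 2 ≤ S) :
    ∫⁻ x, ‖cprofileField V B Q t x‖ₑ ^ 2 ≤
      ENNReal.ofReal S * ∑ p : Fin 2 × A, volume (revolve (closure (U p.1 p.2))) := by
  -- pointwise: `‖v‖ₑ² ≤ Σ_p S · 1_{R(Ū_p)}`
  have hpt : ∀ x, ‖cprofileField V B Q t x‖ₑ ^ 2 ≤
      ∑ p : Fin 2 × A, (revolve (closure (U p.1 p.2))).indicator (fun _ => ENNReal.ofReal S) x := by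
    intro x
    rw [← ofReal_norm, ← ENNReal.ofReal_pow (norm_nonneg _)]
    by_cases hx : ∃ p : Fin 2 × A, meridian x ∈ closure (U p.1 p.2)
    · obtain ⟨p, hp⟩ := hx
      rw [h.cprofileField_eq_of_mem hF ht p hp, (h.slice hF p.1 p.2 ht).norm_swirlField_eq x]
      calc ENNReal.ofReal (Q p.1 p.2 t (meridian x) ^ 2) ≤ ENNReal.ofReal S :=
            ENNReal.ofReal_le_ofReal (hS p.1 p.2 _)
        _ = (revolve (closure (U p.1 p.2))).indicator (fun _ => ENNReal.ofReal S) x := by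
            rw [indicator_of_mem (show x ∈ revolve (closure (U p.1 p.2)) from hp)]
        _ ≤ ∑ p' : Fin 2 × A, (revolve (closure (U p'.1 p'.2))).indicator (fun _ => ENNReal.ofReal S) x :=
            Finset.single_le_sum (f := fun p' : Fin 2 × A =>
              (revolve (closure (U p'.1 p'.2))).indicator (fun _ => ENNReal.ofReal S) x)
              (fun _ _ => zero_le) (Finset.mem_univ p)
    · push Not at hx
      rw [h.cprofileField_eq_zero hF ht hx, norm_zero]
      simp
  calc ∫⁻ x, ‖cprofileField V B Q t x‖ₑ ^ 2
      ≤ ∫⁻ x, ∑ p : Fin 2 × A, (revolve (closure (U p.1 p.2))).indicator (fun _ => ENNReal.ofReal S) x :=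
        lintegral_mono hpt
    _ = ∑ p : Fin 2 × A, ∫⁻ x, (revolve (closure (U p.1 p.2))).indicator (fun _ => ENNReal.ofReal S) x :=
        lintegral_finsetSum' _ fun p _ => (aemeasurable_const.indicator
          (IsNSIStructureFamily.measurableSet_revolve U p))
    _ = ∑ p : Fin 2 × A, ENNReal.ofReal S * volume (revolve (closure (U p.1 p.2))) :=
        Finset.sum_congr rfl fun p _ => by
          rw [lintegral_indicator (IsNSIStructureFamily.measurableSet_revolve U p), setLIntegral_const]
    _ = ENNReal.ofReal S * ∑ p : Fin 2 × A, volume (revolve (closure (U p.1 p.2))) := by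
        rw [Finset.mul_sum]

/-- **The dissipation density of a slice** against a pointwise bound of the summands: if
`|∇u[B_i^mV_i^m, Q_i^m(t)]|² ≤ Λ` everywhere for every `(i,m)`, then
`∫ |∇v(t)|² ≤ Λ · Σ_{(i,m)} |R(Ū_i^m)|` (locally `∇v = ∇u_{i,m}` or `0`; Ożański §6.3 Step 3:
"`|∇v(x,t)| ≤ Σ_𝔪 |∇u[…] + ∇u[…]| ≤ max_𝔪 𝒞(…)`", "`∫₀ᵀ‖∇v‖² ≤ 𝔐𝒞`").
[cite: Ozanski2017NSISingular, §6.3 Step 3 ((iv), dissipation)] -/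
theorem lintegral_frobenius_cprofileField_le (hF : IsNSIStructureFamily U V f φ)
    (h : IsNSICantorProfileData U V f φ H T η δ ε C B Q) {t : ℝ} (ht : t ∈ Ioo (-η) (T + η))
    {Λ : ℝ} (hΛ : ∀ (p : Fin 2 × A) (x : EuclideanSpace ℝ (Fin 3)),
      frobeniusNormSq (fderiv ℝ (swirlField (B p.1 p.2 t • V p.1 p.2) (Q p.1 p.2 t)) x) ≤ Λ) :
    ∫⁻ x, ENNReal.ofReal (frobeniusNormSq (fderiv ℝ (cprofileField V B Q t) x)) ≤
      ENNReal.ofReal Λ * ∑ p : Fin 2 × A, volume (revolve (closure (U p.1 p.2))) := by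
  have hpt : ∀ x, ENNReal.ofReal (frobeniusNormSq (fderiv ℝ (cprofileField V B Q t) x)) ≤
      ∑ p : Fin 2 × A, (revolve (closure (U p.1 p.2))).indicator (fun _ => ENNReal.ofReal Λ) x := by
    intro x
    by_cases hx : ∃ p : Fin 2 × A, meridian x ∈ closure (U p.1 p.2)
    · obtain ⟨p, hp⟩ := hx
      rw [(h.cprofileField_eventuallyEq_of_mem hF ht p hp).fderiv_eq]
      calc ENNReal.ofReal (frobeniusNormSq (fderiv ℝ (swirlField (B p.1 p.2 t • V p.1 p.2) (Q p.1 p.2 t)) x))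
            ≤ ENNReal.ofReal Λ := ENNReal.ofReal_le_ofReal (hΛ p x)
        _ = (revolve (closure (U p.1 p.2))).indicator (fun _ => ENNReal.ofReal Λ) x := by
            rw [indicator_of_mem (show x ∈ revolve (closure (U p.1 p.2)) from hp)]
        _ ≤ ∑ p' : Fin 2 × A, (revolve (closure (U p'.1 p'.2))).indicator (fun _ => ENNReal.ofReal Λ) x :=
            Finset.single_le_sum (f := fun p' : Fin 2 × A =>
              (revolve (closure (U p'.1 p'.2))).indicator (fun _ => ENNReal.ofReal Λ) x)
              (fun _ _ => zero_le) (Finset.mem_univ p)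
    · push Not at hx
      rw [(h.cprofileField_eventuallyEq_zero hF ht hx).fderiv_eq, fderiv_const_apply,
        frobeniusNormSq_zero, ENNReal.ofReal_zero]
      exact zero_le
  calc ∫⁻ x, ENNReal.ofReal (frobeniusNormSq (fderiv ℝ (cprofileField V B Q t) x))
      ≤ ∫⁻ x, ∑ p : Fin 2 × A, (revolve (closure (U p.1 p.2))).indicator (fun _ => ENNReal.ofReal Λ) x :=
        lintegral_mono hpt
    _ = ∑ p : Fin 2 × A, ∫⁻ x, (revolve (closure (U p.1 p.2))).indicator (fun _ => ENNReal.ofReal Λ) x :=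
        lintegral_finsetSum' _ fun p _ => (aemeasurable_const.indicator
          (IsNSIStructureFamily.measurableSet_revolve U p))
    _ = ∑ p : Fin 2 × A, ENNReal.ofReal Λ * volume (revolve (closure (U p.1 p.2))) :=
        Finset.sum_congr rfl fun p _ => by
          rw [lintegral_indicator (IsNSIStructureFamily.measurableSet_revolve U p), setLIntegral_const]
    _ = ENNReal.ofReal Λ * ∑ p : Fin 2 × A, volume (revolve (closure (U p.1 p.2))) := by
        rw [Finset.mul_sum]

end IsNSICantorProfileData

end Literature.Barriers.NavierStokesRegularity
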